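import Mathlib
import HarnessLib
import Literature.RingTheory.CohomologyAnnihilator.Basic
import Summits.ResolutionOfSingularities.ResolutionOfSingularities.Theorems.HomologicalConductorNoZenoBirthDefs
import Summits.ResolutionOfSingularities.ResolutionOfSingularities.Theorems.HomologicalConductorPersistenceSurfaceLevelFour
import Summits.ResolutionOfSingularities.ResolutionOfSingularities.Theorems.HomologicalConductorPersistenceSurfaceRational
import Summits.ResolutionOfSingularities.ResolutionOfSingularities.Theorems.HomologicalConductorPersistenceSurfaceNormalPartition
import Summits.ResolutionOfSingularities.ResolutionOfSingularities.Theorems.HomologicalConductorPersistenceSurfaceTowerDim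
import Summits.ResolutionOfSingularities.ResolutionOfSingularities.Theorems.HomologicalConductorPersistencePeriodicSaturationStage
import Summits.ResolutionOfSingularities.ResolutionOfSingularities.Theorems.HomologicalConductorPersistencePeriodicSaturationBirthStage

/-!
# Rung S-2 `PersistenceSurface` — the Sat₄ RESIDUAL CUT (w44b ORDER o11, CHAIN v9 §V9.3)

Route `ResolutionOfSingularities/HomologicalConductor`, chain W4.4b, rung S-2 `PersistenceSurface`
(stmt-ResolutionOfSingularities-19970).  [OURS · L1 w44b · res-type-011 on ORDER w44b-o11 of
res-L1-w44b-plan-1 (2026-08-27T07:33Z); the presentation predicate is res-L1-w44b-tri-1's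
(`L/res-L1-w44b-tri-1/o9/AuditO9.lean` 77ecda1e3e3d4c18, AUDIT-o9 §5.1); AI-written, weaker than expert
review; NOT a statement of the manuscript under study, and no statement of that manuscript is used.]

The `Sat₄` obligation of the S-2 theorem shape (`SaturationFourSurface`, o3 p503336: at every stage
`T_m` of a surface tower, `ca(T_m) ⊆ ca⁴(T_m)`) is DISCHARGED BY NAME in the kernel at two kinds of
stages by the o9 lineage (p506413 · p507177 · p508342 · p509489 · BirthStage):
* REGULAR stages — `caⁿ(T) = T` for `n ≥ dim T + 1` (`PeriodicSaturationStage.ca_subset_caAt_of_isRegularLocalRing`,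
  with `dim T_m ≤ 2` from `PersistenceSurfaceTowerDim.ringKrullDim_tower_le_of_ringKrullDim_le`);
* stages PRESENTED as MONIC-HYPERSURFACE LOCALISATIONS `↥T_m ≃+* U⁻¹(k[x,y][X]/(f))`, `f` monic
  (`PeriodicSaturationStage.ca_subset_caAt_four_of_ringEquiv_localization_adjoinRoot`: Eisenbud
  periodicity ⇒ `ca = ca³ ⊆ ca⁴`, characteristic-free, no recurrence hypothesis) — every RDP normal
  form, every `zᵖ + F(x,y)`, the E₁₂ hypersurface chart, at stage `0` from the affine presentation alone
  (`isMonicHypersurfaceLocalization_tower_zero`).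

This file cuts the conjecture down to the RESIDUAL:

* `IsMonicHypersurfaceLocalization k d T` — tri-1's presentation predicate (∃ `f` monic over
  `k[x₁,…,x_d]`, ∃ `U`, `T ≃+* U⁻¹(k[x₁,…,x_d][X]/(f))`);
* `@[conjecture] SaturationFourSurfaceResidual` — o3's `SaturationFourSurface` with its conclusion
  restricted to the stages that are NEITHER regular NOR presented monic-hypersurface localisations over
  `k[x,y]` (content on paper: (Rec)-saturation at rational stages of embedding dimension `≥ 4` — cyclic
  PROVED in the chain's markdown REC-CYCLIC + referee; abstract hypersurface stages not yet PRESENTED —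
  tri-1's bridge B2, not ordered; non-rational / non-normal non-hypersurface stages — open);
* `saturationFourSurface_of_residual : SaturationFourSurfaceResidual → SaturationFourSurface` (per stage:
  `by_cases` regular → o9d; `by_cases` presented → o9d; else the residual), and the projections to the
  o6/o6b classes `saturationFourRational_of_residual`, `saturationFourRationalNormal_of_residual`,
  `saturationFourNonrational_of_residual`, `saturationFourNonnormalOrNonrational_of_residual`;
* `persistenceSurface_of_residual_of_levelFour` — the rung from the residual Sat₄ and `L₄` (o3 glue);
* stage `0`: `isMonicHypersurfaceLocalization_tower_zero` (from `e : ↥A ≃+* AdjoinRoot f`, `A ⊆ O`); the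
  surface conclusion `ca (tower O A 0) ⊆ caAt 4 (tower O A 0)` is BirthStage's
  `birth_ca_tower_zero_subset_caAt_four` (p510536), not restated here.

Net for S-2 (CHAIN v9): `PersistenceSurface ⟸ SaturationFourSurfaceResidual ∧ L₄` with the regular
and presented-hypersurface entries of the Sat₄ column discharged by name.
-/

noncomputable section

-- single-problem summit: the doubled namespace component `ResolutionOfSingularities` is forced
set_option linter.dupNamespace false

namespace Summit.ResolutionOfSingularities.ResolutionOfSingularities.Theorems.HomologicalConductor.PersistenceSurfaceSaturationResidual

open CategoryTheory CategoryTheory.Abelian Literature.RingTheory.CohomologyAnnihilator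
open Summit.ResolutionOfSingularities.ResolutionOfSingularities.Theorems.NoZeno.Birth
open Summit.ResolutionOfSingularities.ResolutionOfSingularities.Theorems.HomologicalConductor.PersistenceSurfaceLevelFour
open Summit.ResolutionOfSingularities.ResolutionOfSingularities.Theorems.HomologicalConductor.PersistenceSurfaceRational
open Summit.ResolutionOfSingularities.ResolutionOfSingularities.Theorems.HomologicalConductor.PersistenceSurfaceNormalPartition
open Summit.ResolutionOfSingularities.ResolutionOfSingularities.Theorems.HomologicalConductor.PersistenceSurfaceTowerDim
open Summit.ResolutionOfSingularities.ResolutionOfSingularities.Theorems.HomologicalConductor.PeriodicSaturationStage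
open Summit.ResolutionOfSingularities.ResolutionOfSingularities.Theorems.HomologicalConductor.PeriodicSaturationBirthStage

/-! ## (1) The presentation predicate (res-L1-w44b-tri-1, AuditO9.lean) -/

/-- **`IsMonicHypersurfaceLocalization k d T`** [OURS · predicate by res-L1-w44b-tri-1, AuditO9.lean
77ecda1e3e3d4c18]: the ring `T` is PRESENTED as (ring-isomorphic to) a localisation of a MONIC relative
hypersurface `k[x₁,…,x_d][X]/(f)` over the polynomial ring in `d` variables — the consumer-side
hypothesis under which the o9 lineage gives `ca(T) = caᵈ⁺¹(T)`. NOT a statement of the manuscript.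
[this work] -/
def IsMonicHypersurfaceLocalization (k : Type) [Field k] (d : ℕ) (T : Type) [CommRing T] : Prop :=
  ∃ f : Polynomial (MvPolynomial (Fin d) k), f.Monic ∧
    ∃ U : Submonoid (AdjoinRoot f), Nonempty (T ≃+* Localization U)

/-- `ca(T) = caᵈ⁺¹(T)` for every monic-hypersurface localisation (o9c/o9d transported). [OURS] -/
theorem cohomologyAnnihilator_eq_of_isMonicHypersurfaceLocalization {k : Type} [Field k] {d : ℕ}
    {T : Type} [CommRing T] (h : IsMonicHypersurfaceLocalization k d T) :
    cohomologyAnnihilator T = cohomologyAnnihilatorOfDegree T (d + 1) := by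
  obtain ⟨f, hf, U, ⟨e⟩⟩ := h
  exact cohomologyAnnihilator_eq_of_ringEquiv_localization_powerBasis (AdjoinRoot.powerBasis' hf)
    (cohomologyAnnihilatorOfDegree_mvPolynomial_eq_top k d) U e

variable {k K : Type} [Field k] [Field K] [Algebra k K]

/-- **`Satₙ` at a presented monic-hypersurface stage** (`NoZeno.Birth` vocabulary): for a subalgebra
stage `T ⊆ K` with `IsMonicHypersurfaceLocalization k d ↥T`, `ca T ⊆ caAt n T` for every `n ≥ d + 1`.
[OURS] -/
theorem ca_subset_caAt_of_isMonicHypersurfaceLocalization (T : Subalgebra k K) {d n : ℕ}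
    (h : IsMonicHypersurfaceLocalization k d ↥T) (hn : d + 1 ≤ n) :
    NoZeno.Birth.ca T ⊆ {x : K | ∃ hx : x ∈ T, ∀ i : ℕ, n ≤ i → ∀ (M N : ModuleCat.{0} ↥T),
      Module.Finite ↥T M → Module.Finite ↥T N →
        ∀ e : CategoryTheory.Abelian.Ext.{0} M N i, (⟨x, hx⟩ : ↥T) • e = 0} := by
  obtain ⟨f, hf, U, ⟨e⟩⟩ := h
  exact birth_ca_subset_caAt_of_ringEquiv_localization_adjoinRoot T hf U e hn

/-- **Stage `0` is presented whenever the starting algebra is**: from `e : ↥A ≃+* k[x₁,…,x_d][X]/(f)`,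
`f` monic, and `A ⊆ O`, the stage `tower O A 0 = loc O A` is a monic-hypersurface localisation
(`PeriodicSaturationBirthStage.nonempty_ringEquiv_loc_localization`). [OURS, after res-L1-w44b-tri-1] -/
theorem isMonicHypersurfaceLocalization_tower_zero (O : ValuationSubring K) (A : Subalgebra k K)
    (hAO : A.toSubring ≤ O.toSubring) {d : ℕ} {f : Polynomial (MvPolynomial (Fin d) k)}
    (hf : f.Monic) (e : ↥A ≃+* AdjoinRoot f) :
    IsMonicHypersurfaceLocalization k d ↥(NoZeno.Birth.tower O A 0) := by
  rw [NoZeno.Birth.tower_zero]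
  exact ⟨f, hf, _, nonempty_ringEquiv_loc_localization O A hAO e⟩

/-! ## (2) The residual conjecture -/

/-- **`SaturationFourSurfaceResidual` (OURS · w44b-o11)** — o3's `SaturationFourSurface` (binders
VERBATIM) with the conclusion restricted to the RESIDUAL stages: at every stage `T_m` that is NEITHER a
regular local ring NOR presented as a monic-hypersurface localisation over `k[x,y]`,
`ca(T_m) ⊆ ca⁴(T_m)`.  Content on paper (CHAIN v9): (Rec)-saturation at rational stages of embedding
dimension `≥ 4` (cyclic: the chain's REC-CYCLIC note, refereed; non-quotient: REC-RATIONAL row), abstract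
hypersurface stages not yet presented (tri-1's bridge B2), non-rational / non-normal non-hypersurface
stages (open). NOT a statement of the manuscript. [this work] -/
@[conjecture]
def SaturationFourSurfaceResidual : Prop :=
  ∀ p : ℕ, p.Prime → ∀ (k K : Type) [Field k] [CharP k p] [Field K] [Algebra k K] (O : ValuationSubring K) (A : Subalgebra k K), (∀ c : k, algebraMap k K c ∈ O) → A.FG → IsFractionRing ↥A K → A.toSubring ≤ O.toSubring → ringKrullDim ↥A ≤ 2 → let caAt : ℕ → Subalgebra k K → Set K := fun n A => {x : K | ∃ hx : x ∈ A, ∀ i : ℕ, n ≤ i → ∀ (M N : ModuleCat.{0} ↥A), Module.Finite ↥A M → Module.Finite ↥A N → ∀ e : CategoryTheory.Abelian.Ext.{0} M N i, (⟨x, hx⟩ : ↥A) • e = 0}; let ca : Subalgebra k K → Set K := fun A => {x : K | ∃ hx : x ∈ A, ∃ n : ℕ, ∀ i : ℕ, n ≤ i → ∀ (M N : ModuleCat.{0} ↥A), Module.Finite ↥A M → Module.Finite ↥A N → ∀ e : CategoryTheory.Abelian.Ext.{0} M N i, (⟨x, hx⟩ : ↥A) • e = 0}; let loc : Subalgebra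 k K → Subalgebra k K := fun A => Algebra.adjoin k {y : K | ∃ a ∈ A, ∃ s ∈ A, s⁻¹ ∈ O ∧ y = a * s⁻¹}; let chart : Subalgebra k K → Subalgebra k K := fun A => Algebra.adjoin k ((A : Set K) ∪ {y : K | ∃ c ∈ ca A, ∃ x ∈ ca A, x ≠ 0 ∧ (∀ c' ∈ ca A, c' * x⁻¹ ∈ O) ∧ y = c * x⁻¹}); let nrm : Subalgebra k K → Subalgebra k K := fun B => Algebra.adjoin k {y : K | IsIntegral ↥B y}; let tower : Subalgebra k K → ℕ → Subalgebra k K := fun A m => @Nat.rec (fun _ => Subalgebra k K) (loc A) (fun _ B => loc (nrm (chart B))) m; ∀ m : ℕ, ¬ IsRegularLocalRing ↥(tower A m) → ¬ IsMonicHypersurfaceLocalization k 2 ↥(tower A m) → ca (tower A m) ⊆ caAt 4 (tower A m)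

/-! ## (3) The cut: `SaturationFourSurfaceResidual → SaturationFourSurface` -/

/-- A nontrivial ring of Krull dimension `≤ d` has Krull dimension SOME natural number `≤ d`
(`ringKrullDim` lives in `WithBot ℕ∞`). [folklore] -/
theorem exists_ringKrullDim_eq_nat {T : Type} [CommRing T] [Nontrivial T] {d : ℕ}
    (h : ringKrullDim T ≤ d) : ∃ d' : ℕ, ringKrullDim T = d' ∧ d' ≤ d := by
  have h0 : (0 : WithBot ℕ∞) ≤ ringKrullDim T := ringKrullDim_nonneg_of_nontrivial
  generalize hq : ringKrullDim T = q at h0 h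
  induction q using WithBot.recBotCoe with
  | bot => exact absurd h0 (by simp)
  | coe q =>
    induction q using ENat.recTopCoe with
    | top =>
      exfalso
      have h' : (⊤ : ℕ∞) ≤ (d : ℕ∞) := WithBot.coe_le_coe.mp h
      exact absurd (top_le_iff.mp h') (ENat.coe_ne_top d)
    | coe d' =>
      refine ⟨d', rfl, ?_⟩
      have h' : (d' : ℕ∞) ≤ (d : ℕ∞) := WithBot.coe_le_coe.mp h
      exact_mod_cast h'

/-- **THE CUT.** `SaturationFourSurface` follows from its residual: at a REGULAR stage `caⁿ = ⊤`
(`n ≥ dim + 1`, `dim T_m ≤ 2`, o9d `ca_subset_caAt_of_isRegularLocalRing`); at a PRESENTED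
monic-hypersurface stage Eisenbud periodicity gives `ca = ca³ ⊆ ca⁴` (o9d
`ca_subset_caAt_four_of_ringEquiv_localization_adjoinRoot`); every other stage is the residual
hypothesis. [OURS] -/
theorem saturationFourSurface_of_residual (h : SaturationFourSurfaceResidual) :
    SaturationFourSurface := by
  intro p hp k K _ _ _ _ O A hk hA hfr hAO hdim caAt ca loc chart nrm tower m x hx
  by_cases hreg : IsRegularLocalRing ↥(NoZeno.Birth.tower O A m)
  · -- regular stage: `caⁿ(T_m) = ⊤` for `n ≥ dim T_m + 1`, and `dim T_m ≤ 2 < 4`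
    haveI := hreg
    haveI := hfr
    have hdim2 : ringKrullDim ↥(NoZeno.Birth.tower O A m) ≤ (2 : ℕ) :=
      ringKrullDim_tower_le_of_ringKrullDim_le O A hA hdim m
    obtain ⟨d, hd, hd2⟩ := exists_ringKrullDim_eq_nat (d := 2) hdim2
    have hd4 : d + 1 ≤ 4 := by omega
    exact ca_subset_caAt_of_isRegularLocalRing (NoZeno.Birth.tower O A m) hd hd4 hx
  · by_cases hmon : IsMonicHypersurfaceLocalization k 2 ↥(NoZeno.Birth.tower O A m)
    · obtain ⟨f, hf, U, ⟨e⟩⟩ := hmon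
      exact ca_subset_caAt_four_of_ringEquiv_localization_adjoinRoot k hf U
        (NoZeno.Birth.tower O A m) e hx
    · exact h p hp k K O A hk hA hfr hAO hdim m hreg hmon hx

/-! ## (4) Projections to the o6 / o6b classes and the rung -/

/-- The residual gives Sat₄ on the rational class (R) (o6). [OURS] -/
theorem saturationFourRational_of_residual (h : SaturationFourSurfaceResidual) :
    SaturationFourRational :=
  saturationFourRational_of_surface (saturationFourSurface_of_residual h)

/-- The residual gives Sat₄ on the complementary class ¬(R) (o6). [OURS] -/
theorem saturationFourNonrational_of_residual (h : SaturationFourSurfaceResidual) :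
    SaturationFourNonrational :=
  saturationFourNonrational_of_surface (saturationFourSurface_of_residual h)

/-- The residual gives Sat₄ on the normal-rational class (R♮) (o6b). [OURS] -/
theorem saturationFourRationalNormal_of_residual (h : SaturationFourSurfaceResidual) :
    SaturationFourRationalNormal :=
  saturationFourRationalNormal_of_rational (saturationFourRational_of_residual h)

/-- Projection of `SaturationFourSurface` to the class ¬(R♮) (the o6b analogue of o6's
`saturationFourNonrational_of_surface`). [folklore] -/
theorem saturationFourNonnormalOrNonrational_of_surface (h : SaturationFourSurface) :
    SaturationFourNonnormalOrNonrational := by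
  intro p hp k K _ _ _ _ O A hk hA hfr hAO hdim caAt ca loc chart nrm tower _ m x hx
  exact h p hp k K O A hk hA hfr hAO hdim m hx

/-- The residual gives Sat₄ on the class ¬(R♮) (o6b). [OURS] -/
theorem saturationFourNonnormalOrNonrational_of_residual (h : SaturationFourSurfaceResidual) :
    SaturationFourNonnormalOrNonrational :=
  saturationFourNonnormalOrNonrational_of_surface (saturationFourSurface_of_residual h)

/-- **The rung from the residual**: `PersistenceSurface ⟸ SaturationFourSurfaceResidual ∧ L₄`
(o3 glue `persistenceSurface_of_saturationFour_of_levelFour`). [OURS] -/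
theorem persistenceSurface_of_residual_of_levelFour (hS : SaturationFourSurfaceResidual)
    (hL : LevelFourPersistenceSurface) :
    Summit.ResolutionOfSingularities.ResolutionOfSingularities.Theses.HomologicalConductor.PersistenceSurface :=
  persistenceSurface_of_saturationFour_of_levelFour (saturationFourSurface_of_residual hS) hL

/-- The rung from the residual and the four-piece partition of o6b: Sat₄ residual + `L₄` on (R♮) and on
¬(R♮) (`persistenceSurface_of_normalPieces`). [OURS] -/
theorem persistenceSurface_of_residual_of_normalPieces (hS : SaturationFourSurfaceResidual)
    (hLR : LevelFourPersistenceRationalNormal) (hLN : LevelFourPersistenceNonnormalOrNonrational) :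
    Summit.ResolutionOfSingularities.ResolutionOfSingularities.Theses.HomologicalConductor.PersistenceSurface :=
  persistenceSurface_of_normalPieces (saturationFourRationalNormal_of_residual hS)
    (saturationFourNonnormalOrNonrational_of_residual hS) hLR hLN

end Summit.ResolutionOfSingularities.ResolutionOfSingularities.Theorems.HomologicalConductor.PersistenceSurfaceSaturationResidual

end
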